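import Summits.QuantumFields.QCD.Theses.EulerDescent
import Literature.MathematicalPhysics.QuantumFieldTheory.QCDCurrentSector
import Literature.MathematicalPhysics.QuantumFieldTheory.QCDTorusTranslation
import Summits.QuantumFields.QCD.Theorems.EulerDescentChiralCornerSoftnessStubSlabFluxBound
import HarnessLib

/-!
# Sub-goal `stub_twistedPPCeiling_timeReflect` of stub `stub_twistedPPCeiling` (E2+E4), line `Sketch`
(twisted-ray Goldstone bound) of crux `Summit.QuantumFields.QCD.Theses.EulerDescent.ChiralCornerSoftness`
(item stmt-QuantumFields-16902)

**Time reflection of the twisted zero-momentum charged correlator: `C(−s) = C(s)`.**  For `N_f` Wilson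
flavours on the torus of side `2S+1`, a doublet `(f,g)`, degenerate bare mass `m₀` and twisted mass `μ` on
`(f,g)` (fermionic weight `W(U) = e^{−ψ̄(D_W(U,m₀) + iμγ₅τ³)ψ}`), the zero-momentum correlator of the charged
density `P¹ = ψ̄γ₅τ¹ψ`,

  `C(s) = Σ_{y⃗ ∈ {−S,…,S}³} ⟨P¹(0) P¹(s, y⃗)⟩_tw`,

is an even function of the Euclidean time `s ∈ ℤ`.  This makes the two-sided slab decay bound of E2+E4
one-sided.

## Proof (everything is proved; no named fact, no hypothesis beyond the registered signature)

* §1 — **translation covariance of the TWISTED functional** (the untwisted case is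
  `qcdTorusExpect_quarkTranslate` of `QCDTorusTranslation`): the twisted mass `iμγ₅τ³` is site-diagonal and
  site-INDEPENDENT, so its enumerated matrix is fixed by the doubled relabelling `quarkShift u × quarkShift u`
  (`twist_quarkShift_apply`), while the Wilson–Dirac matrix is covariant (`diracMatrix_torusConfigShift`);
  hence `u · W(U) = W(τ_u U)` (`quarkTranslate_twWeight`).  For ANY weight `W` with this covariance the
  numerator `∫dμ_W ∫dψ̄dψ X(U) W(U)` is unchanged under `X ↦ u · X(τ_{−u} ·)` (Berezin integral and Wilson
  measure are translation invariant: `fermiIntegral_quarkTranslate`, `integral_comp_torusConfigShift_wilson`),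
  so two-point numerators of placed local observables depend on the sites only through their difference
  (`twoPointNumerator_translate`, via `QCDLatticeObservable.onTorus_add`).
* §2 — the placed densities are quadratic (even) Grassmann elements (`densityObs_onTorus`), hence central
  (`commute_quadQ`): `⟨P¹(0)P¹(x)⟩ = ⟨P¹(−x)P¹(0)⟩ = ⟨P¹(0)P¹(−x)⟩` at the level of Wilson-integrated Berezin
  numerators (`density_twoPoint_neg`); the common denominator is untouched.
* §3 — the spatial box `{−S,…,S}³` is symmetric under `y⃗ ↦ −y⃗` (`sum_box_comp_neg`) and
  `(−s, −y⃗) = −(s, y⃗)` (`Matrix.neg_cons`), which reindexes `C(−s)` into `C(s)` (`twistedCorr_neg_eq`).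

References: I. Montvay, G. Münster, *Quantum Fields on a Lattice* (CUP 1994), §4.1 (4.21) and §5.1
(translation invariance of the Wilson–Dirac action and of the Berezin measure); K. Osterwalder, E. Seiler,
Ann. Phys. 110 (1978) 440, §2 (lattice symmetries of gauge theories with fermions); R. Frezzotti, P. A. Grassi,
S. Sint, P. Weisz, JHEP 08 (2001) 058, §2.1 (twisted-mass lattice QCD); F. A. Berezin, *The Method of Second
Quantization* (1966), Ch. I §3.
-/

noncomputable section

namespace Summit.QuantumFields.QCD.Cruxes.ChiralCornerSoftness.TwistedRay

open Filter Topology MeasureTheory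
open Literature.MathematicalPhysics.QuantumFieldTheory Literature.MathematicalPhysics.QuantumLattice
  Literature.Probability.LatticeModels

namespace TimeReflect

open SlabFluxWard Literature.MathematicalPhysics.QuantumLattice.GrassmannAlgebra

/-! ### §1 Translation covariance of the twisted functional -/

section Covariance

variable {Nf L : ℕ} [NeZero L]

/-- **The twisted mass is site independent**: its enumerated matrix is fixed by the doubled site relabelling
`quarkShift u × quarkShift u`. [folklore] -/
theorem twist_quarkShift_apply (f g : Fin Nf) (μl : ℝ) (u : TorusSite 4 L) (p r : FermiIdx Nf L) :
    Matrix.reindex quarkEquiv quarkEquiv (twistQ (L := L) f g μl) (quarkShift u p) (quarkShift u r) =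
      Matrix.reindex quarkEquiv quarkEquiv (twistQ (L := L) f g μl) p r := by
  obtain ⟨⟨f', x, c⟩, rfl⟩ := quarkEquiv.surjective p
  obtain ⟨⟨g', y, e⟩, rfl⟩ := quarkEquiv.surjective r
  simp only [quarkShift_quarkEquiv, Matrix.reindex_apply, Matrix.submatrix_apply, Equiv.symm_apply_apply,
    twistQ, Matrix.of_apply, sub_left_inj]

/-- **Translation covariance of the twisted fermionic Boltzmann factor**: `u · W(U) = W(τ_u U)` for
`W(U) = e^{−ψ̄(D_W(U,m₀) + iμγ₅τ³)ψ}` — the Wilson–Dirac matrix is covariant and the twisted mass is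
translation invariant. [cite: MontvayMunster1994, §4.1 and §5.1] [cite: FrezzottiGrassiSintWeisz2001, §2.1] -/
theorem quarkTranslate_twWeight (u : TorusSite 4 L) (U : GaugeConfig 4 L (Matrix.specialUnitaryGroup (Fin 3) ℂ))
    (m₀ μl : ℝ) (f g : Fin Nf) :
    quarkTranslate Nf u (grassmannExp (quadratic ℂ (-(diracMatrix U (fun _ : Fin Nf => m₀) +
        Matrix.reindex quarkEquiv quarkEquiv (twistQ f g μl))))) =
      grassmannExp (quadratic ℂ (-(diracMatrix (torusConfigShift u U) (fun _ : Fin Nf => m₀) +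
        Matrix.reindex quarkEquiv quarkEquiv (twistQ f g μl)))) := by
  have key : ∀ a : FermiAlg Nf L, quarkTranslate Nf u (grassmannExp a) = grassmannExp (quarkTranslate Nf u a) :=
    fun a => map_funLeft_grassmannExp ℂ (quarkTranslateEquiv Nf u) a
  have hM : (-(diracMatrix U (fun _ : Fin Nf => m₀) + Matrix.reindex quarkEquiv quarkEquiv (twistQ f g μl))).submatrix
        (quarkShift u) (quarkShift u) =
      -(diracMatrix (torusConfigShift u U) (fun _ : Fin Nf => m₀) +
        Matrix.reindex quarkEquiv quarkEquiv (twistQ f g μl)) := by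
    ext p r
    simp only [Matrix.submatrix_apply, Matrix.neg_apply, Matrix.add_apply, diracMatrix_torusConfigShift,
      twist_quarkShift_apply]
  rw [key, quarkTranslate_quadratic, hM]

/-- **Translation covariance of a Wilson-integrated Berezin numerator with a covariant weight**: if
`u · W(U) = W(τ_u U)` for all `u, U`, then `∫dμ_W ∫dψ̄dψ (u · X(τ_{−u}U)) W(U) = ∫dμ_W ∫dψ̄dψ X(U) W(U)` for every
Grassmann-valued `X` (Berezin integral and Wilson state are translation invariant; no measurability of `X` is
needed). [cite: MontvayMunster1994, §4.1 (4.21) and §5.1] [cite: OsterwalderSeiler1978, §2] -/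
theorem integral_fermiIntegral_quarkTranslate (β : ℝ)
    {W : GaugeConfig 4 L (Matrix.specialUnitaryGroup (Fin 3) ℂ) → FermiAlg Nf L}
    (hW : ∀ (u : TorusSite 4 L) (U : GaugeConfig 4 L (Matrix.specialUnitaryGroup (Fin 3) ℂ)),
      quarkTranslate Nf u (W U) = W (torusConfigShift u U))
    (u : TorusSite 4 L) (X : GaugeConfig 4 L (Matrix.specialUnitaryGroup (Fin 3) ℂ) → FermiAlg Nf L) :
    ∫ U, fermiIntegral (quarkTranslate Nf u (X (torusConfigShift (-u) U)) * W U)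
        ∂(wilsonMeasure (d := 4) (L := L) (fundamentalRep (Fin 3)) β) =
      ∫ U, fermiIntegral (X U * W U) ∂(wilsonMeasure (d := 4) (L := L) (fundamentalRep (Fin 3)) β) := by
  have hB : ∀ U : GaugeConfig 4 L (Matrix.specialUnitaryGroup (Fin 3) ℂ),
      W U = quarkTranslate Nf u (W (torusConfigShift (-u) U)) := by
    intro U
    rw [hW, torusConfigShift_torusConfigShift, add_neg_cancel, torusConfigShift_zero']
  calc ∫ U, fermiIntegral (quarkTranslate Nf u (X (torusConfigShift (-u) U)) * W U)
          ∂(wilsonMeasure (d := 4) (L := L) (fundamentalRep (Fin 3)) β)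
      = ∫ U, (fun V => fermiIntegral (X V * W V)) (torusConfigShift (-u) U)
          ∂(wilsonMeasure (d := 4) (L := L) (fundamentalRep (Fin 3)) β) := by
        refine integral_congr_ae (Eventually.of_forall fun U => ?_)
        simp only
        rw [hB U, ← map_mul, fermiIntegral_quarkTranslate]
    _ = ∫ U, fermiIntegral (X U * W U) ∂(wilsonMeasure (d := 4) (L := L) (fundamentalRep (Fin 3)) β) :=
        integral_comp_torusConfigShift_wilson β (-u) (fun V => fermiIntegral (X V * W V))

/-- **Two-point numerators with a covariant weight are translation invariant**: for gauge-invariant local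
observables `A`, `B` placed at `x + v`, `y + v`, the Wilson-integrated Berezin numerator does not depend on `v`.
[cite: OsterwalderSeiler1978, §2] -/
theorem twoPointNumerator_translate {R R' : ℕ} (β : ℝ)
    {W : GaugeConfig 4 L (Matrix.specialUnitaryGroup (Fin 3) ℂ) → FermiAlg Nf L}
    (hW : ∀ (u : TorusSite 4 L) (U : GaugeConfig 4 L (Matrix.specialUnitaryGroup (Fin 3) ℂ)),
      quarkTranslate Nf u (W U) = W (torusConfigShift u U))
    (A : QCDLatticeObservable Nf R) (B : QCDLatticeObservable Nf R')
    (x y v : Literature.Probability.LatticeModels.Site 4) :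
    ∫ U, fermiIntegral (A.onTorus L (x + v) U * B.onTorus L (y + v) U * W U)
        ∂(wilsonMeasure (d := 4) (L := L) (fundamentalRep (Fin 3)) β) =
      ∫ U, fermiIntegral (A.onTorus L x U * B.onTorus L y U * W U)
        ∂(wilsonMeasure (d := 4) (L := L) (fundamentalRep (Fin 3)) β) := by
  simp only [QCDLatticeObservable.onTorus_add _ _ v, ← map_mul]
  exact integral_fermiIntegral_quarkTranslate β hW (Torus.proj L v) (fun U => A.onTorus L x U * B.onTorus L y U)

/-! ### §2 Even commutativity: reflecting the relative coordinate of the charged two-point numerator -/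

/-- The placed charged density is a quadratic (even) Grassmann element, hence central. [folklore] -/
theorem commute_density_onTorus (f g : Fin Nf) (v : Literature.Probability.LatticeModels.Site 4)
    (U : GaugeConfig 4 L (Matrix.specialUnitaryGroup (Fin 3) ℂ)) (z : FermiAlg Nf L) :
    Commute ((pseudoscalarDensityObs Nf (tau1M f g)).onTorus L v U) z := by
  rw [densityObs_onTorus]
  exact commute_quadQ _ z

/-- **`⟨P¹(0) P¹(−x)⟩ = ⟨P¹(0) P¹(x)⟩` at the level of twisted numerators**: translate by `−x`
(`twoPointNumerator_translate`) and commute the two even densities. [cite: OsterwalderSeiler1978, §2] -/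
theorem density_twoPoint_neg (β m₀ μl : ℝ) (f g : Fin Nf) (x : Literature.Probability.LatticeModels.Site 4) :
    ∫ U, fermiIntegral ((pseudoscalarDensityObs Nf (tau1M f g)).onTorus L 0 U *
          (pseudoscalarDensityObs Nf (tau1M f g)).onTorus L (-x) U *
          grassmannExp (quadratic ℂ (-(diracMatrix U (fun _ : Fin Nf => m₀) +
            Matrix.reindex quarkEquiv quarkEquiv (twistQ f g μl)))))
        ∂(wilsonMeasure (d := 4) (L := L) (fundamentalRep (Fin 3)) β) =
      ∫ U, fermiIntegral ((pseudoscalarDensityObs Nf (tau1M f g)).onTorus L 0 U *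
          (pseudoscalarDensityObs Nf (tau1M f g)).onTorus L x U *
          grassmannExp (quadratic ℂ (-(diracMatrix U (fun _ : Fin Nf => m₀) +
            Matrix.reindex quarkEquiv quarkEquiv (twistQ f g μl)))))
        ∂(wilsonMeasure (d := 4) (L := L) (fundamentalRep (Fin 3)) β) := by
  have h := twoPointNumerator_translate (L := L) β (fun u U => quarkTranslate_twWeight u U m₀ μl f g)
    (pseudoscalarDensityObs Nf (tau1M f g)) (pseudoscalarDensityObs Nf (tau1M f g)) 0 x (-x)
  rw [zero_add, add_neg_cancel] at h
  rw [← h]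
  refine integral_congr_ae (Eventually.of_forall fun U => ?_)
  simp only
  rw [(commute_density_onTorus f g 0 U _).eq]

end Covariance

/-! ### §3 The symmetric spatial box and the reflected correlator -/

section Box

variable {Nf : ℕ}

/-- **The spatial box `{−S,…,S}³` is symmetric**: reindexing a box sum by `y⃗ ↦ −y⃗`. [folklore] -/
theorem sum_box_comp_neg {M : Type*} [AddCommMonoid M] (S : ℕ)
    (F : Literature.Probability.LatticeModels.Site 3 → M) :
    ∑ y ∈ box 3 S, F (-y) = ∑ y ∈ box 3 S, F y := by
  have hneg : ∀ y ∈ box 3 S, -y ∈ box 3 S := fun y hy => by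
    rw [mem_box] at hy ⊢
    intro i
    have := hy i
    simp only [Pi.neg_apply]
    omega
  exact Finset.sum_nbij' (fun y => -y) (fun y => -y) hneg hneg (fun y _ => neg_neg y) (fun y _ => neg_neg y)
    fun _ _ => rfl

/-- **`C(−s) = C(s)` for the twisted zero-momentum charged correlator** (numerators over the Wilson measure,
common denominator). [cite: MontvayMunster1994, §4.1 and §5.1] [cite: OsterwalderSeiler1978, §2] -/
theorem twistedCorr_neg_eq (f g : Fin Nf) (β m₀ μl : ℝ) (S : ℕ) (s : ℤ) :
    ∑ y ∈ box 3 S,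
        (∫ U, fermiIntegral ((pseudoscalarDensityObs Nf (tau1M f g)).onTorus (2 * S + 1) 0 U *
              (pseudoscalarDensityObs Nf (tau1M f g)).onTorus (2 * S + 1) (Matrix.vecCons (-s) y) U *
              grassmannExp (quadratic ℂ (-(diracMatrix U (fun _ : Fin Nf => m₀) +
                Matrix.reindex quarkEquiv quarkEquiv (twistQ f g μl)))))
            ∂(wilsonMeasure (d := 4) (L := 2 * S + 1) (fundamentalRep (Fin 3)) β)) /
          (∫ U, fermiIntegral (grassmannExp (quadratic ℂ (-(diracMatrix U (fun _ : Fin Nf => m₀) +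
              Matrix.reindex quarkEquiv quarkEquiv (twistQ f g μl)))))
            ∂(wilsonMeasure (d := 4) (L := 2 * S + 1) (fundamentalRep (Fin 3)) β)) =
      ∑ y ∈ box 3 S,
        (∫ U, fermiIntegral ((pseudoscalarDensityObs Nf (tau1M f g)).onTorus (2 * S + 1) 0 U *
              (pseudoscalarDensityObs Nf (tau1M f g)).onTorus (2 * S + 1) (Matrix.vecCons s y) U *
              grassmannExp (quadratic ℂ (-(diracMatrix U (fun _ : Fin Nf => m₀) +
                Matrix.reindex quarkEquiv quarkEquiv (twistQ f g μl)))))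
            ∂(wilsonMeasure (d := 4) (L := 2 * S + 1) (fundamentalRep (Fin 3)) β)) /
          (∫ U, fermiIntegral (grassmannExp (quadratic ℂ (-(diracMatrix U (fun _ : Fin Nf => m₀) +
              Matrix.reindex quarkEquiv quarkEquiv (twistQ f g μl)))))
            ∂(wilsonMeasure (d := 4) (L := 2 * S + 1) (fundamentalRep (Fin 3)) β)) := by
  rw [← sum_box_comp_neg S (fun y => (∫ U, fermiIntegral
      ((pseudoscalarDensityObs Nf (tau1M f g)).onTorus (2 * S + 1) 0 U *
          (pseudoscalarDensityObs Nf (tau1M f g)).onTorus (2 * S + 1) (Matrix.vecCons (-s) y) U *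
          grassmannExp (quadratic ℂ (-(diracMatrix U (fun _ : Fin Nf => m₀) +
            Matrix.reindex quarkEquiv quarkEquiv (twistQ f g μl)))))
        ∂(wilsonMeasure (d := 4) (L := 2 * S + 1) (fundamentalRep (Fin 3)) β)) /
      (∫ U, fermiIntegral (grassmannExp (quadratic ℂ (-(diracMatrix U (fun _ : Fin Nf => m₀) +
          Matrix.reindex quarkEquiv quarkEquiv (twistQ f g μl)))))
        ∂(wilsonMeasure (d := 4) (L := 2 * S + 1) (fundamentalRep (Fin 3)) β)))]
  refine Finset.sum_congr rfl fun y _ => ?_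
  rw [← Matrix.neg_cons, density_twoPoint_neg]

end Box

end TimeReflect

open TimeReflect in
/-- **Sub-goal `stub_twistedPPCeiling_timeReflect` of (E2+E4) — time reflection of the twisted zero-momentum
charged correlator.**  For the twisted-mass Wilson doublet `(f,g)` (weight `e^{−ψ̄(D_W(U,m₀) + iμγ₅τ³)ψ}` on the
torus of side `2S+1`), the zero-momentum correlator `C(s) = Σ_{y⃗ ∈ {−S,…,S}³} ⟨P¹(0) P¹(s,y⃗)⟩_tw` of the charged
density `P¹ = ψ̄γ₅τ¹ψ` satisfies `C(−s) = C(s)` for every `s ∈ ℤ` and all `β, m₀, μ, S`: translation covariance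
of the twisted functional (site-independent twist; covariant Wilson–Dirac matrix; invariant Berezin integral and
Wilson state) moves `⟨P¹(0)P¹(x)⟩` to `⟨P¹(−x)P¹(0)⟩`, the two even densities commute, and the spatial box is
symmetric under `y⃗ ↦ −y⃗`. [cite: MontvayMunster1994, §4.1 (4.21) and §5.1] [cite: OsterwalderSeiler1978, §2] -/
theorem stub_twistedPPCeiling_timeReflect : ∀ (Nf : ℕ) (f g : Fin Nf) (β m₀ μl : ℝ) (S : ℕ) (s : ℤ), let τ1 : Matrix (Fin Nf) (Fin Nf) ℂ := Matrix.single f g 1 + Matrix.single g f 1; let P1 : QCDLatticeObservable Nf 1 := pseudoscalarDensityObs Nf τ1; let Tw := fun (S : ℕ) (μl : ℝ) => Matrix.reindex (quarkEquiv (Nf := Nf) (L := 2 * S + 1)) quarkEquiv (Matrix.of fun v w : QuarkVar Nf (2 * S + 1) => if v.1 = w.1 ∧ v.2.1 = w.2.1 ∧ v.2.2.1 = w.2.2.1 then (if v.1 = f then (1 : ℂ) else if v.1 = g then -1 else 0) * ((μl : ℂ) * Complex.I) * gammaFive v.2.2.2 w.2.2.2 else 0); let E := fun (β m₀ μl : ℝ)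 (S : ℕ) (X : GaugeConfig 4 (2 * S + 1) (Matrix.specialUnitaryGroup (Fin 3) ℂ) → FermiAlg Nf (2 * S + 1)) => (∫ U, fermiIntegral (X U * grassmannExp (quadratic ℂ (-(diracMatrix U (fun _ : Fin Nf => m₀) + Tw S μl)))) ∂(wilsonMeasure (d := 4) (L := 2 * S + 1) (fundamentalRep (Fin 3)) β)) / (∫ U, fermiIntegral (grassmannExp (quadratic ℂ (-(diracMatrix U (fun _ : Fin Nf => m₀) + Tw S μl)))) ∂(wilsonMeasure (d := 4) (L := 2 * S + 1) (fundamentalRep (Fin 3)) β)); let C := fun (β m₀ μl : ℝ) (S : ℕ) (s : ℤ) => ∑ y ∈ box 3 S, E β m₀ μl S (fun U => P1.onTorus (2 * S + 1) 0 U * P1.onTorus (2 * S + 1) (Matrix.vecCons s y) U); C β m₀ μl S (-s) = C β m₀ μl S s := by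
  intro Nf f g β m₀ μl S s
  dsimp only
  exact twistedCorr_neg_eq f g β m₀ μl S s

end Summit.QuantumFields.QCD.Cruxes.ChiralCornerSoftness.TwistedRay
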